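import Literature.Computability.AlgebraicComplexity.ConstituentStageCompatCoarse
import Literature.Computability.AlgebraicComplexity.GlobalStageExponentCertificate
import HarnessLib

/-!
# Class sizes of the coarse datum of the constituent stage at a consistent triple
(Vassilevska Williams–Xu–Xu–Zhou 2024, Def. 6.14 / Claim 6.13) — proved

Topic `Literature/Computability/AlgebraicComplexity`.  In the exponent of one region of the
constituent stage (`ConstituentRegion.exponentE₁`, `ConstituentStageEpsilon.lean`) the compatibility
term is `Λ = ∑_{(t, class)} |class| · H(β_class)` over the coarse classes of Def. 6.14 at a consistent
reference triple (`coarseTermMap₂`, `coarseTermList₂`, `ConstituentStageCompatCoarse.lean`).  This file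
computes the class sizes from the `{α_t}` counts alone — they do not depend on the chosen triple:

* `ConstituentRegion.classWeight D t (i',j',k')` — `cnt t (i',j',k') + cnt t (i_t−i', j_t−j', k_t−k')`
  inside the box, `0` outside — and `card_pairClass_of_consistent`: `|S_{t,i',j',k'}| = classWeight`
  at every consistent remaining triple (§6.6: "`A_{t,1}(α_t(i',j',k') + α_t(i_t−i',j_t−j',k_t−k')) n_t`
  positions");
* `ConstituentRegion.ppClassWeight`, `card_pairClassPP_of_consistent` — the same for `S_{t,+,+,k'}`;
* **`ConstituentRegion.coarseLambda_eq_sum`** — `Λ` as the sum over terms of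
  `∑_{i'=0 ∨ j'=0} classWeight · H(β_{Z,t,i',j',k'}) + ∑_{k'} ppClassWeight · H(β̄_{t,k'})`.

Everything is proved; the two definitions are the closed-form weights.  Used by the rational-data
certificate of Thm. 6.3 (`ConstituentStageExponentCertificate.lean`) and by the term-matching data of
the §8 recursion.

## References

* V. Vassilevska Williams, Y. Xu, Z. Xu, R. Zhou, *New bounds for matrix multiplication: from alpha
  to omega*, SODA 2024, arXiv:2307.07970 (held: `paper:arxiv-2307.07970`): §6.6, Def. 6.14,
  Claim 6.13. [VassilevskaWilliamsXuXuZhou2024]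
-/

noncomputable section

open scoped BigOperators
open Finset

namespace Literature.Computability.AlgebraicComplexity

/-! ## Class sizes of the coarse datum at a consistent triple -/

namespace ConstituentRegion

open scoped Classical

variable {c n s M : ℕ}

/-- **The size of the class `S_{t,i',j',k'}` at an `{α_t}`-consistent triple, from the counts**:
`cnt t (i',j',k') + cnt t (i_t − i', j_t − j', k_t − k')` inside the box `(i',j',k') ≤ (i_t,j_t,k_t)`,
`0` outside. [cite: VassilevskaWilliamsXuXuZhou2024, §6.6 ("A_{t,1} · (α_t(i',j',k') + α_t(i_t−i',j_t−j',k_t−k')) · n_t level-(ℓ−1) positions")] -/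
def classWeight (D : ConstituentRegion c n s M) (t : Fin s) (ijk : ℕ × ℕ × ℕ) : ℕ :=
  if ijk.1 ≤ (D.L t).i ∧ ijk.2.1 ≤ (D.L t).j ∧ ijk.2.2 ≤ (D.L t).k then
    D.cnt t ijk + D.cnt t ((D.L t).i - ijk.1, (D.L t).j - ijk.2.1, (D.L t).k - ijk.2.2)
  else 0

/-- **The size of the class `S_{t,+,+,k'}` at an `{α_t}`-consistent triple, from the counts**: the sum of
the class sizes over the box triples `(i',j',k')` with `i', j' ≠ 0`. [cite: VassilevskaWilliamsXuXuZhou2024, Def. 6.14 (2)] -/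
def ppClassWeight (D : ConstituentRegion c n s M) (t : Fin s) (k : ℕ) : ℕ :=
  ∑ ijk ∈ (boxTriples c (D.L t) k).filter (fun ijk => ¬ (ijk.1 = 0 ∨ ijk.2.1 = 0)),
    (D.cnt t ijk + D.cnt t ((D.L t).i - ijk.1, (D.L t).j - ijk.2.1, (D.L t).k - ijk.2.2))

variable {D : ConstituentRegion c n s M}
variable {T₀ : (Fin (n + n) → Fin (2 * c + 1)) × (Fin (n + n) → Fin (2 * c + 1)) × (Fin (n + n) → Fin (2 * c + 1))}

/-- A position of term `t` of a triple inside the level-`ℓ` blocks has its `X`-index `≤ i_t` (and likewise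
for `Y`, `Z`). [cite: VassilevskaWilliamsXuXuZhou2024, §6 (preamble)] -/
theorem apply_le_of_inside {I J K : Fin (n + n) → Fin (2 * c + 1)} (hI : InsideX D.τ D.L I) (hJ : InsideY D.τ D.L J)
    (hK : InsideZ D.τ D.L K) (p : Fin (n + n)) :
    (I p : ℕ) ≤ (D.L (halfTermOf D.τ p)).i ∧ (J p : ℕ) ≤ (D.L (halfTermOf D.τ p)).j ∧ (K p : ℕ) ≤ (D.L (halfTermOf D.τ p)).k := by
  induction p using Fin.addCases with
  | left u =>
    have h1 := hI u; have h2 := hJ u; have h3 := hK u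
    rw [halfTermOf_castAdd]
    omega
  | right u =>
    have h1 := hI u; have h2 := hJ u; have h3 := hK u
    rw [halfTermOf_natAdd]
    omega

/-- **`|S_{t,i',j',k'}| = classWeight`** at a consistent remaining triple. [cite: VassilevskaWilliamsXuXuZhou2024, §6.6] -/
theorem card_pairClass_of_consistent (hD : D.WellFormed) (hT₀ : T₀ ∈ D.consistent) (t : Fin s) (i j k : ℕ) :
    (pairClass D.τ (seqVal T₀.1) (seqVal T₀.2.1) (seqVal T₀.2.2) t i j k).card = D.classWeight t (i, j, k) := by
  obtain ⟨hT, hcnt⟩ := mem_filter.1 hT₀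
  obtain ⟨-, hI, hJ, hK⟩ := tripleSet_good hD hT
  unfold classWeight
  split_ifs with hbox
  · rw [card_pairClass_eq D.τ D.L hI hJ hK t hbox.1 hbox.2.1 hbox.2.2, hcnt t (i, j, k), hcnt t (_, _, _)]
  · rw [Finset.card_eq_zero, Finset.eq_empty_iff_forall_notMem]
    intro p hp
    rw [mem_pairClass] at hp
    obtain ⟨ht, h1, h2, h3⟩ := hp
    have hle := apply_le_of_inside hI hJ hK p
    rw [ht] at hle
    simp only [seqVal] at h1 h2 h3
    exact hbox ⟨h1 ▸ hle.1, h2 ▸ hle.2.1, h3 ▸ hle.2.2⟩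

/-- **`|S_{t,+,+,k'}| = ppClassWeight`** at a consistent remaining triple. [cite: VassilevskaWilliamsXuXuZhou2024, Def. 6.14 (2)] -/
theorem card_pairClassPP_of_consistent (hD : D.WellFormed) (hT₀ : T₀ ∈ D.consistent)
    (h₀ : IsLevelTriple c (seqVal T₀.1) (seqVal T₀.2.1) (seqVal T₀.2.2)) (t : Fin s) (k : ℕ) :
    (pairClassPP D.τ (seqVal T₀.1) (seqVal T₀.2.1) (seqVal T₀.2.2) t k).card = D.ppClassWeight t k := by
  obtain ⟨hT, -⟩ := mem_filter.1 hT₀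
  obtain ⟨-, hI, hJ, hK⟩ := tripleSet_good hD hT
  have key := card_filter_pairClassPP_eq_sum D.τ D.L h₀ hI hJ hK t k (fun _ => True)
  simp only [Finset.filter_true] at key
  rw [key, ppClassWeight]
  refine sum_congr rfl fun ijk hijk => ?_
  obtain ⟨-, -, hi, hj, hk⟩ := mem_boxTriples.1 (mem_filter.1 hijk).1
  rw [card_pairClass_of_consistent hD hT₀, classWeight, if_pos ⟨hi, hj, hk⟩]

/-- **The `λ`-sum of the exponent at a consistent triple, as a sum over terms and coarse classes**:
`∑_{(t, class)} |class| · H(β_class) = ∑_t (∑_{i'=0 ∨ j'=0} classWeight · H(β_{Z,t,i',j',k'}) + ∑_{k'} ppClassWeight · H(β̄_{t,k'}))`.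
[cite: VassilevskaWilliamsXuXuZhou2024, Def. 6.14 and Claim 6.13 (λ_{Z,t})] -/
theorem coarseLambda_eq_sum (hD : D.WellFormed) (hT₀ : T₀ ∈ D.consistent)
    (h₀ : IsLevelTriple c (seqVal T₀.1) (seqVal T₀.2.1) (seqVal T₀.2.2))
    (βZ : Fin s → ℕ × ℕ × ℕ → (Fin c → Fin 3) → ℝ) (βPP : Fin s → ℕ → (Fin c → Fin 3) → ℝ) :
    ∑ idx, ((classOf (coarseTermMap₂ D.τ h₀) idx).card : ℝ) * shannonEntropy (coarseTermList₂ c s βZ βPP idx).γX =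
      ∑ t, ((∑ x ∈ RegionWeights.bdTriples c, (D.classWeight t x : ℝ) * shannonEntropy (βZ t x)) +
        ∑ k ∈ range (2 * c + 1), (D.ppClassWeight t k : ℝ) * shannonEntropy (βPP t k)) := by
  -- reindex over `Fin s × Fin |coarseClasses c|`
  rw [← Equiv.sum_comp finProdFinEquiv, Fintype.sum_prod_type]
  refine Fintype.sum_congr _ _ fun t => ?_
  -- as a sum over the coarse classes
  have step : ∑ e : Fin (coarseClasses c).card,
      ((classOf (coarseTermMap₂ D.τ h₀) (finProdFinEquiv (t, e))).card : ℝ) *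
        shannonEntropy (coarseTermList₂ c s βZ βPP (finProdFinEquiv (t, e))).γX =
      ∑ cl ∈ coarseClasses c, ((univ.filter fun p => halfTermOf D.τ p = t ∧
        coarseClassOf (seqVal T₀.1) (seqVal T₀.2.1) (seqVal T₀.2.2) p = cl).card : ℝ) * shannonEntropy (coarseBeta βZ βPP t cl) := by
    rw [← Finset.sum_coe_sort (coarseClasses c)]
    refine Fintype.sum_equiv (coarseClasses c).equivFin.symm _ _ fun e => ?_
    have hcls : classOf (coarseTermMap₂ D.τ h₀) (finProdFinEquiv (t, e)) =
        univ.filter fun p => halfTermOf D.τ p = t ∧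
          coarseClassOf (seqVal T₀.1) (seqVal T₀.2.1) (seqVal T₀.2.2) p = ((coarseClasses c).equivFin.symm e).1 :=
      filter_coarseTermMap₂_eq D.τ h₀ t e
    have hlist : (coarseTermList₂ c s βZ βPP (finProdFinEquiv (t, e))).γX = coarseBeta βZ βPP t ((coarseClasses c).equivFin.symm e).1 := by
      simp only [coarseTermList₂, Equiv.symm_apply_apply]
    rw [hcls, hlist]
  rw [step, coarseClasses, sum_union, sum_image, sum_image]
  · congr 1
    · refine sum_congr rfl fun x hx => ?_
      obtain ⟨i, j, k⟩ := x
      have hb : i = 0 ∨ j = 0 := (mem_filter.1 hx).2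
      rw [filter_halfTerm_coarseClassOf_some D.τ t hb, card_pairClass_of_consistent hD hT₀]
      rfl
    · refine sum_congr rfl fun k _ => ?_
      rw [filter_halfTerm_coarseClassOf_none D.τ t, card_pairClassPP_of_consistent hD hT₀ h₀]
      rfl
  · intro k₁ _ k₂ _ hk
    simpa using hk
  · intro x _ y _ hxy
    simp only [Prod.mk.injEq, Option.some.injEq] at hxy
    exact Prod.ext hxy.1.1 (Prod.ext hxy.1.2 hxy.2)
  · rw [Finset.disjoint_left]
    intro cl h1 h2
    obtain ⟨x, _, rfl⟩ := mem_image.1 h1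
    obtain ⟨k, _, hk⟩ := mem_image.1 h2
    simp at hk

end ConstituentRegion

end Literature.Computability.AlgebraicComplexity
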